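import Summits.ResolutionOfSingularities.ResolutionOfSingularities.Theorems.HomologicalConductorNoZenoRContractionIsBlowup
import HarnessLib

/-!
# Crux `NoZenoR` (stmt-ResolutionOfSingularities-19943) — an `S`-morphism of desingularizations is an isomorphism iff it
# preserves the number of integral exceptional curves; the `IsBlowup` clause of Lipman (27.1) at `F = {η}`, literally

Route `ResolutionOfSingularities/HomologicalConductor` (cell decomp-res, hand leafhand-res-homologicalconduct-18 g1).
OURS: AI-written bookkeeping over tree theorems, weaker than expert review; nothing here is a statement of the
manuscript under review (Hironaka 2017).  SUPPORT level, counted 0.  Def-free, no new named facts.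

* `isIso_iff_ncard_excCurvePoints_eq` — for `S` a two-dimensional Noetherian local normal domain, `ρ : Y → Spec S`
  and `π : X → Spec S` desingularizations and `h : X → Y` with `h ≫ ρ = π`: `h` is an isomorphism iff
  `#excCurvePoints π = #excCurvePoints ρ` (a non-isomorphism strictly raises the count,
  `ncard_excCurvePoints_succ_le_of_not_isIso`; an isomorphism and its inverse both can only raise it,
  `ncard_excCurvePoints_le_of_comp`);
* `isBlowup_of_contracts_singleton` — `FirstKind.isBlowup_of_contracts_one` restated with the LITERAL clause shapes of
  the named fact `Lipman1969_27_1_reg_rat` at `F = {η}` (`IsIso (h ∣_ (h '' F)ᶜ)`, `IsBlowup h (vanishingIdeal (h '' F))`):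
  at one curve, the last clause of (27.1) follows from the fibre clause and the isomorphism clause.

No crux or summit statement is proved here.
-/

noncomputable section

-- single-problem summit: the doubled namespace component `ResolutionOfSingularities` is forced
set_option linter.dupNamespace false

open CategoryTheory AlgebraicGeometry TopologicalSpace Topology IsLocalRing
open Literature.AlgebraicGeometry.Resolution
open Scheme.IdealSheafData
open Summit.ResolutionOfSingularities.ResolutionOfSingularities.Theorems.NoZeno.ExcCount.FirstKind

namespace Summit.ResolutionOfSingularities.ResolutionOfSingularities.Theorems.NoZeno.FirstKind

variable {S : Type} [CommRing S] [IsNoetherianRing S] [IsLocalRing S] [IsDomain S] [IsIntegrallyClosed S]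
  {X Y : Scheme.{0}} {ρ : Y ⟶ Spec (.of S)} {h : X ⟶ Y}

/-- **An `S`-morphism of desingularizations is an isomorphism iff it preserves the number of integral exceptional
curves.** [cite: Lipman1969, Corollary (27.3), proof (p. 277)] -/
theorem isIso_iff_ncard_excCurvePoints_eq (h2 : ringKrullDim S = 2) {π : X ⟶ Spec (.of S)}
    (hπ : IsResolution π) (hρ : IsResolution ρ) (hfac : h ≫ ρ = π) :
    IsIso h ↔ (excCurvePoints π).ncard = (excCurvePoints ρ).ncard := by
  constructor
  · intro hI
    subst hfac
    have h1 := ncard_excCurvePoints_le_of_comp h2 ρ h hρ hπ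
    -- the inverse is an `S`-morphism the other way
    have hfac' : inv h ≫ h ≫ ρ = ρ := by rw [IsIso.inv_hom_id_assoc]
    have hρ' : IsResolution (inv h ≫ h ≫ ρ) := by rw [hfac']; exact hρ
    have h2' := ncard_excCurvePoints_le_of_comp h2 (h ≫ ρ) (inv h) hπ hρ'
    rw [hfac'] at h2'
    exact le_antisymm h2' h1
  · intro heq
    by_contra hne
    have := ncard_excCurvePoints_succ_le_of_not_isIso h2 hπ hρ hfac hne
    omega

/-- **The `IsBlowup` clause of `Lipman1969_27_1_reg_rat` at `F = {η}` follows from its fibre and isomorphism clauses.**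
For `S` a two-dimensional Noetherian local normal domain, `ρ : Y → Spec S` and `h ≫ ρ` desingularizations,
`η ∈ excCurvePoints (h ≫ ρ)`, `hC : IsClosed (h '' {η})`, the fibre clause `∀ η' ∈ {η}, h⁻¹(h η') = cl{η'}` and the
isomorphism clause `IsIso (h ∣_ (h '' {η})ᶜ)`: `IsBlowup h (vanishingIdeal ⟨h '' {η}, hC⟩)`.
[cite: Lipman1969, Theorem (27.1) (p. 275) with Theorem (4.1) (p. 204)] -/
theorem isBlowup_of_contracts_singleton (h2 : ringKrullDim S = 2) (hπ : IsResolution (h ≫ ρ))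
    (hρ : IsResolution ρ) {η : X} (hη : η ∈ excCurvePoints (h ≫ ρ))
    (hC : IsClosed (h.base '' ({η} : Set X)))
    (hfib : ∀ η' ∈ ({η} : Set X), h.base ⁻¹' {h.base η'} = closure {η'})
    (hiso : IsIso (h ∣_ (⟨(h.base '' ({η} : Set X))ᶜ, hC.isOpen_compl⟩ : Y.Opens))) :
    IsBlowup h (vanishingIdeal ⟨h.base '' ({η} : Set X), hC⟩) := by
  have himg : h.base '' ({η} : Set X) = {h.base η} := Set.image_singleton
  have hy : IsClosed ({h.base η} : Set Y) := himg ▸ hC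
  have hU : (⟨(h.base '' ({η} : Set X))ᶜ, hC.isOpen_compl⟩ : Y.Opens) = ⟨{h.base η}ᶜ, hy.isOpen_compl⟩ :=
    TopologicalSpace.Opens.ext (by rw [TopologicalSpace.Opens.coe_mk, TopologicalSpace.Opens.coe_mk, himg])
  haveI : IsIso (h ∣_ (⟨{h.base η}ᶜ, hy.isOpen_compl⟩ : Y.Opens)) :=
    ((MorphismProperty.isomorphisms Scheme).arrow_mk_iso_iff (morphismRestrictEq h hU)).mp hiso
  have hcl : (⟨h.base '' ({η} : Set X), hC⟩ : Closeds Y) = ⟨{h.base η}, hy⟩ := Closeds.ext himg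
  rw [hcl]
  exact isBlowup_of_contracts_one h2 hπ hρ hη hy (hfib η (Set.mem_singleton η))

end Summit.ResolutionOfSingularities.ResolutionOfSingularities.Theorems.NoZeno.FirstKind

end
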